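import Summits.BirchSwinnertonDyer.Rank1Residual.X11b.UnramifiedFrobeniusCongruence
import Summits.BirchSwinnertonDyer.Rank1Residual.X11b.PadicInertiaCharacter
import Summits.BirchSwinnertonDyer.Rank1Residual.X11b.PadicLangTate
import Literature.NumberTheory.GaloisRepresentations.InertiaRootsOfUnity
import Literature.NumberTheory.GaloisRepresentations.LocalGaloisGroupHenselProofs
import HarnessLib

/-!
# X11b, S29 T6 (G3) part 2: A NUMBER FIELD UNRAMIFIED ABOVE `p` IS FIXED BY THE INERTIA OF `ℚ̄_p`

HONEST FRAMING (cell `b2b-bsdres`, run/shared/lean/b2b/bsd-rank1-residual/, verbatim in every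
file): the goal of the cell is to DELETE the COMBINATION-SHAPED residual classes of the
Birch–Swinnerton-Dyer formula for ALL analytic-rank `≤ 1` elliptic curves over `ℚ` — assembled
STRICTLY from published theorems — so that the rank-`≤ 1` remainder becomes exactly the
CONSTRUCTION-SHAPED classes, which are TYPED, NOT attempted. This is not "finishing BSD". Team N8/O2
(X11b at `3`: `3 ‖ N`, `r_an = 1`, `E[3]` irreducible); deal S29 (x11b3-lead GEN 8, OWNERS R9-8),
kernel lemma T6 (= G3, dealt R9-42 / R9-43), seat `b2b-bsdres-x11b3-p5` (gen. 6); consumer = K4-C's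
labelled binder `hUnr` (x11b3-p7, INBOX l.5038, `K4-INTERFACES.md` v4 §T6). WORDING OF RECORD (H45,
R9-8): S29 RE-EXPRESSES (t) ⟸ (VR); this file is an UNCONDITIONAL kernel lemma and SUPPLIES
NOTHING of the class record by itself; the node `Three.HsiehDescentAt₃` is UNCHANGED; O2 OPEN / N8
CONSTRUCTION; nothing booked. THEOREMS ONLY (no definition, no named fact, no `sorry`); every `p`.

## What this file proves

**T6** (`apply_symm_eq_of_forall_rootsOfUnity_of_ramificationIdx_eq_one`, p7's text VERBATIM):
for `ι : ℚ̄_p ≃+* ℂ`, a subfield `F ⊂ ℂ` finite over `ℚ` in which every prime above `p` has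
ramification index `1`, and `τ ∈ Aut(ℚ̄_p/ℚ_p)` fixing every root of unity of order prime to `p`
("INERTIA(τ)"), `τ` fixes `ι⁻¹(F)` pointwise.  It is what (VR-B)'s clause "`F` unramified above `3`"
buys in S29: `σ_τ = ι ∘ τ ∘ ι⁻¹` fixes `F` for `τ` in the inertia group.

ROAD "C" (a contraction argument; no local field `F_P`, no Galois group of `F`, no Teichmüller
digits, no completion):
* (a) `norm_apply_sub_lt_one_of_forall_rootsOfUnity` — INERTIA(τ) puts `τ` in the tree's inertia
  group `absInertia ℚ_[p]` (x11b3-p1's `PadicSemiInvariant.mem_absInertia_of_forall_rootsOfUnity`,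
  tree `mem_absInertia_iff_smul_rootsOfUnity`), hence `‖τ z − z‖ < 1` for every `z ∈ ℚ̄_p` integral
  over `ℤ` (definition of `absInertia` + tree `mem_radical_map_maximalIdeal_iff`);
* (b) the FROBENIUS CONGRUENCE of `𝓞 F` (`UnramifiedFrobeniusCongruence.lean`): `x^q ≡ x (mod p)`,
  `q = p^f ≥ 2`;
* (c) CONTRACTION: `norm_add_pow_sub_pow_le` (`‖(y+d)^q − y^q‖ ≤ max (‖p‖‖d‖) ‖d‖^q` for
  `‖y‖, ‖d‖ ≤ 1`, since `p ∣ C(q,i)` for `0 < i < q`); with `y_i = ι⁻¹(b_i)` for a `ℤ`-basis `(b_i)`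
  of `𝓞 F` and `M = max_i ‖τ y_i − y_i‖ < 1`: every `y ∈ ι⁻¹(𝓞 F)` has `‖τ y − y‖ ≤ M` (ultrametric),
  `y_i = y_i^q − p z_i` gives `‖τ y_i − y_i‖ ≤ max (‖p‖ M) (M^q)`, so `M ≤ max (‖p‖M) (M^q) < M`
  unless `M = 0`; hence `τ` fixes `ι⁻¹(𝓞 F)` and, by fractions, `ι⁻¹(F)` (`apply_symm_eq_of_mem`).

(The tree's `Literature.NumberTheory.Automorphic.ringHom_padicAlgCl_ext_of_forall_norm_sub_lt_one`
— two embeddings `L → ℚ̄_p` congruent mod `𝔪` on `𝓞 L` coincide when `p ∤ disc L` — is the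
discriminant form of the same rigidity, pointed out by x11b3-p3 GEN 8 (INBOX l.5168); road C keeps
the ramification-index hypothesis of (VR-B) and avoids the `e = 1 ⇔ p ∤ disc` bridge.)

References: J.-P. Serre, *Local Fields*, GTM 67 (1979), Ch. I §8 and Ch. IV §4 (Prop. 16, Cor. 2)
[`SerreLocalFields1979`]; J. Neukirch, *Algebraic Number Theory*, Ch. I (8.3), Ch. II (7.12)
[`NeukirchANT1999`]. Cell files: `cells/x11b3/OWNERS.md` R9-42 / R9-43, INBOX l.5038 / l.5143.
-/

noncomputable section

open scoped NumberField
open ValuativeRel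
open Literature.NumberTheory.GaloisRepresentations
open Literature.NumberTheory.GaloisRepresentations.IsNonarchimedeanLocalField
namespace Summit.BirchSwinnertonDyer.Rank1Residual.X11b.UnramifiedInertia

variable (p : ℕ) [Fact p.Prime]

/-! ### §1. (a) Inertia moves integral elements by less than `1` -/

/-- **INERTIA(τ) ⇒ `‖τ z − z‖ < 1` for `z ∈ ℚ̄_p` integral over `ℤ`.**  An automorphism `τ` of
`ℚ̄_p / ℚ_p` fixing every root of unity of order prime to `p` lies in the inertia group
`I_{ℚ_p} = absInertia ℚ_[p]` (x11b3-p1's `PadicSemiInvariant.mem_absInertia_of_forall_rootsOfUnity`,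
tree `mem_absInertia_iff_smul_rootsOfUnity`: `I_F = Gal(F̄/F(μ_{p'}))`), i.e. `τ z − z` lies in the
maximal ideal of `\bar ℤ_p` for every integral `z` — spectral norm `< 1`
(`mem_radical_map_maximalIdeal_iff`; Mathlib's norm on `PadicAlgCl p` IS the spectral norm).  The
tree's Prop-valued local-field structure on `ℚ_[p]` is an instance binder
(`Padic.isNonarchimedeanLocalField_holds p`).
Ref: Serre, *Local Fields*, Ch. IV §4, Cor. 2 to Prop. 16.
[cite: SerreLocalFields1979, Ch. IV §4 Cor. 2 to Prop. 16] -/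
theorem norm_apply_sub_lt_one_of_forall_rootsOfUnity [IsNonarchimedeanLocalField ℚ_[p]]
    (τ : PadicAlgCl p ≃ₐ[ℚ_[p]] PadicAlgCl p)
    (hτ : ∀ ζ : PadicAlgCl p, (∃ m : ℕ, 0 < m ∧ ¬ p ∣ m ∧ ζ ^ m = 1) → τ ζ = ζ)
    {z : PadicAlgCl p} (hz : IsIntegral ℤ z) : ‖τ z - z‖ < 1 := by
  have hw := PadicInertiaCharacter.valuation_le_one_iff p
  have hσ : (τ : Field.absoluteGaloisGroup ℚ_[p]) ∈ absInertia ℚ_[p] :=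
    PadicSemiInvariant.mem_absInertia_of_forall_rootsOfUnity (p := p) hτ
  -- `z` is integral over `𝒪[ℚ_p]`
  have hz' : z ∈ absIntegers 𝒪[ℚ_[p]] ℚ_[p] := by
    have h1 : IsIntegral 𝒪[ℚ_[p]] z := hz.tower_top
    exact h1
  have hmem := (mem_absInertia_iff.mp hσ) ⟨z, hz'⟩
  have hlt := (mem_radical_map_maximalIdeal_iff hw _).mp hmem
  rw [Subalgebra.coe_sub, integralClosure.coe_smul] at hlt
  exact hlt

/-! ### §2. (c) The binomial estimate and norms of integers -/

/-- **The binomial estimate**: `‖(y + d)^q − y^q‖ ≤ max (‖p‖·‖d‖) (‖d‖^q)` in `ℚ̄_p` for `q = p^f`,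
`‖y‖ ≤ 1`, `‖d‖ ≤ 1` — expand, `p ∣ C(q, i)` for `0 < i < q` (Mathlib `Nat.Prime.dvd_choose_pow`),
ultrametric inequality. [folklore] -/
theorem norm_add_pow_sub_pow_le (f : ℕ) {y d : PadicAlgCl p}
    (hy : ‖y‖ ≤ 1) (hd : ‖d‖ ≤ 1) :
    ‖(y + d) ^ p ^ f - y ^ p ^ f‖ ≤ max (‖(p : PadicAlgCl p)‖ * ‖d‖) (‖d‖ ^ p ^ f) := by
  have hp : p.Prime := Fact.out
  set q := p ^ f with hq
  have hq1 : 1 ≤ q := Nat.one_le_pow _ _ hp.pos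
  -- expand
  have hexp : (y + d) ^ q - y ^ q =
      ∑ m ∈ Finset.range q, y ^ m * d ^ (q - m) * ((q.choose m : ℕ) : PadicAlgCl p) := by
    rw [add_pow, Finset.sum_range_succ, Nat.choose_self, Nat.sub_self, pow_zero, mul_one,
      Nat.cast_one, mul_one, add_sub_cancel_right]
  rw [hexp]
  refine IsUltrametricDist.norm_sum_le_of_forall_le_of_nonneg (le_max_of_le_right
    (pow_nonneg (norm_nonneg _) _)) fun m hm => ?_
  rw [Finset.mem_range] at hm
  rcases Nat.eq_zero_or_pos m with rfl | hm0
  · -- the term `d^q`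
    refine le_max_of_le_right ?_
    rw [pow_zero, one_mul, Nat.sub_zero, Nat.choose_zero_right, Nat.cast_one, mul_one, norm_pow]
  · -- the terms with `p ∣ C(q, m)`
    refine le_max_of_le_left ?_
    have hdvd : p ∣ q.choose m := hp.dvd_choose_pow hm0.ne' hm.ne
    obtain ⟨c, hc⟩ := hdvd
    have hC : ‖((q.choose m : ℕ) : PadicAlgCl p)‖ ≤ ‖(p : PadicAlgCl p)‖ := by
      rw [hc, Nat.cast_mul, norm_mul]
      refine mul_le_of_le_one_right (norm_nonneg _) ?_
      -- `‖c‖ ≤ 1` for the natural number `c` (norm of `ℚ̄_p` extends that of `ℚ_p`)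
      rw [← map_natCast (algebraMap ℚ_[p] (PadicAlgCl p)), ← PadicAlgCl.spectralNorm_eq,
        spectralNorm_extends, ← Int.cast_natCast]
      exact Padic.norm_int_le_one _
    rw [norm_mul, norm_mul, norm_pow, norm_pow]
    calc ‖y‖ ^ m * ‖d‖ ^ (q - m) * ‖((q.choose m : ℕ) : PadicAlgCl p)‖
        ≤ 1 * ‖d‖ * ‖(p : PadicAlgCl p)‖ := by
          refine mul_le_mul (mul_le_mul (pow_le_one₀ (norm_nonneg _) hy) ?_ (pow_nonneg
            (norm_nonneg _) _) zero_le_one) hC (norm_nonneg _) (by positivity)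
          exact pow_le_of_le_one (norm_nonneg _) hd (Nat.sub_ne_zero_of_lt hm)
      _ = ‖(p : PadicAlgCl p)‖ * ‖d‖ := by ring

/-! ### §3. The contraction argument and the export -/

/-- An element of `ℚ̄_p` integral over `ℤ` has norm `≤ 1` (the integral closure of `ℤ_p` in
`ℚ̄_p` is the closed unit ball of the spectral norm, tree
`mem_absIntegers_integer_iff_spectralNorm_le_one`).
Ref: Serre, *Local Fields*, Ch. II §2 Prop. 3. [cite: SerreLocalFields1979, Ch. II §2 Prop. 3] -/
theorem norm_le_one_of_isIntegral [IsNonarchimedeanLocalField ℚ_[p]] {z : PadicAlgCl p}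
    (hz : IsIntegral ℤ z) : ‖z‖ ≤ 1 := by
  have hw := PadicInertiaCharacter.valuation_le_one_iff p
  have hz' : z ∈ absIntegers 𝒪[ℚ_[p]] ℚ_[p] := by
    have h1 : IsIntegral 𝒪[ℚ_[p]] z := hz.tower_top
    exact h1
  exact (mem_absIntegers_integer_iff_spectralNorm_le_one hw z).mp hz'

/-- **T6 in named-binder form: a number field unramified above `p` is fixed by the inertia of
`ℚ̄_p`.**  Let `ι : ℚ̄_p ≃+* ℂ`, `F ⊂ ℂ` a subfield finite over `ℚ` such that every prime `P ∋ p` of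
`𝓞 F` has `P.ramificationIdx (𝓞 ℚ) = 1`, and `τ ∈ Aut(ℚ̄_p/ℚ_p)` fixing every root of unity of order
prime to `p`.  Then `τ (ι⁻¹ x) = ι⁻¹ x` for every `x ∈ F`.  Proof = road C of the module docstring:
(a) `‖τ y − y‖ < 1` on `ι⁻¹(𝓞 F)`; (b) `x^q ≡ x (mod p)` on `𝓞 F`, `q = p^f ≥ 2`
(`exists_pow_prime_pow_sub_mem_span`); (c) with `M = max ‖τ y_i − y_i‖` over a `ℤ`-basis of `𝓞 F`
(`NumberField.RingOfIntegers.basis`), `M ≤ max (‖p‖ M) (M^q)` forces `M = 0`; fractions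
(`IsFractionRing.div_surjective`) finish.  Classically: the closure of `ℚ_p·ι⁻¹(F)` is unramified
over `ℚ_p`, hence inside `ℚ_p^{nr} = ℚ_p(μ_{p'})`, on which the inertia group acts trivially.
Ref: Serre, *Local Fields*, Ch. I §8 and Ch. IV §4 Cor. 2 to Prop. 16; Neukirch, *Algebraic Number
Theory*, Ch. II (7.12). [cite: SerreLocalFields1979, Ch. IV §4 Cor. 2 to Prop. 16]
[cite: NeukirchANT1999, Ch. II §7 (7.12)] -/
theorem apply_symm_eq_of_mem [IsNonarchimedeanLocalField ℚ_[p]]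
    (ι : PadicAlgCl p ≃+* ℂ) (F : IntermediateField ℚ ℂ) (hFd : FiniteDimensional ℚ F)
    (hunr : ∀ P : Ideal (𝓞 F), P.IsPrime → ((p : ℕ) : 𝓞 F) ∈ P → P.ramificationIdx (𝓞 ℚ) = 1)
    (τ : PadicAlgCl p ≃ₐ[ℚ_[p]] PadicAlgCl p)
    (hτ : ∀ ζ : PadicAlgCl p, (∃ m : ℕ, 0 < m ∧ ¬ p ∣ m ∧ ζ ^ m = 1) → τ ζ = ζ)
    (x : ℂ) (hx : x ∈ F) : τ (ι.symm x) = ι.symm x := by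
  classical
  haveI : CharZero F := charZero_of_injective_algebraMap (algebraMap ℚ F).injective
  haveI : NumberField F := { to_charZero := inferInstance, to_finiteDimensional := hFd }
  have hp : p.Prime := Fact.out
  -- norms of `ℤ` and of `p` in `ℚ̄_p` (the norm of `ℚ̄_p` extends that of `ℚ_p`)
  have hnormZ : ∀ n : ℤ, ‖(n : PadicAlgCl p)‖ ≤ 1 := fun n => by
    rw [← map_intCast (algebraMap ℚ_[p] (PadicAlgCl p)), ← PadicAlgCl.spectralNorm_eq,
      spectralNorm_extends]
    exact Padic.norm_int_le_one _
  have hnormp : ‖(p : PadicAlgCl p)‖ < 1 := by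
    rw [← map_natCast (algebraMap ℚ_[p] (PadicAlgCl p)), ← PadicAlgCl.spectralNorm_eq,
      spectralNorm_extends]
    exact Padic.norm_p_lt_one
  -- the embedding `e = ι⁻¹|_F : F → ℚ̄_p` and the derivation-like map `D = τ − 1`
  set e : F →+* PadicAlgCl p := ι.symm.toRingHom.comp (algebraMap F ℂ) with he_def
  have he : ∀ y : F, e y = ι.symm (y : ℂ) := fun y => rfl
  set D : PadicAlgCl p →+ PadicAlgCl p :=
    (τ : PadicAlgCl p →+ PadicAlgCl p) - AddMonoidHom.id _ with hD_def
  have hD : ∀ z, D z = τ z - z := fun z => rfl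
  have hDmul : ∀ (n : PadicAlgCl p) (z : PadicAlgCl p), τ n = n → D (n * z) = n * D z := by
    intro n z hn
    rw [hD, hD, map_mul, hn, mul_sub]
  -- integrality of `e b`, `b ∈ 𝓞 F`
  have hint : ∀ b : 𝓞 F, IsIntegral ℤ (e b) := fun b =>
    (NumberField.RingOfIntegers.isIntegral_coe b).map (e.toIntAlgHom)
  have hnorm : ∀ b : 𝓞 F, ‖e b‖ ≤ 1 := fun b => norm_le_one_of_isIntegral p (hint b)
  have hlt : ∀ b : 𝓞 F, ‖D (e b)‖ < 1 := fun b =>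
    norm_apply_sub_lt_one_of_forall_rootsOfUnity p τ hτ (hint b)
  -- the Frobenius congruence of `𝓞 F`
  obtain ⟨f, hf, hcong⟩ := exists_pow_prime_pow_sub_mem_span p F hunr
  set q := p ^ f with hq
  have hq2 : 2 ≤ q := by
    calc 2 ≤ p := hp.two_le
      _ = p ^ 1 := (pow_one p).symm
      _ ≤ p ^ f := Nat.pow_le_pow_right hp.pos hf
  -- an integral basis and the maximum `M`
  set B := NumberField.RingOfIntegers.basis F with hB
  haveI : Nonempty (Module.Free.ChooseBasisIndex ℤ (𝓞 F)) := B.index_nonempty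
  have hne : (Finset.univ : Finset (Module.Free.ChooseBasisIndex ℤ (𝓞 F))).Nonempty :=
    Finset.univ_nonempty
  set M : ℝ := Finset.univ.sup' hne fun i => ‖D (e (B i))‖ with hM
  have hMi : ∀ i, ‖D (e (B i))‖ ≤ M := fun i =>
    Finset.le_sup' (fun i => ‖D (e (B i))‖) (Finset.mem_univ i)
  have hM0 : 0 ≤ M := (norm_nonneg _).trans (hMi (Classical.arbitrary _))
  have hM1 : M < 1 := by
    rw [hM, Finset.sup'_lt_iff]
    exact fun i _ => hlt (B i)
  -- `‖D (e b)‖ ≤ M` for every `b ∈ 𝓞 F`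
  have hDb : ∀ b : 𝓞 F, ‖D (e b)‖ ≤ M := by
    intro b
    have hb : e b = ∑ i, (B.repr b i : ℤ) • e (B i) := by
      conv_lhs => rw [← B.sum_repr b]
      simp only [NumberField.RingOfIntegers.coe_eq_algebraMap, map_sum, map_zsmul]
    rw [hb, map_sum]
    refine IsUltrametricDist.norm_sum_le_of_forall_le_of_nonneg hM0 fun i _ => ?_
    rw [map_zsmul, zsmul_eq_mul, norm_mul]
    exact (mul_le_of_le_one_left (norm_nonneg _) (hnormZ _)).trans (hMi i)
  -- the key estimate `‖D (e (B i))‖ ≤ max (‖p‖ M) (M ^ q)`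
  have hkey : ∀ i, ‖D (e (B i))‖ ≤ max (‖(p : PadicAlgCl p)‖ * M) (M ^ q) := by
    intro i
    obtain ⟨w, hw⟩ := Ideal.mem_span_singleton'.mp (hcong (B i))
    -- `y = y^q - p·(e w)` with `y = e (B i)`
    set y := e (B i) with hy
    have hyq : y = y ^ q - (p : PadicAlgCl p) * e w := by
      have h1 := congrArg (fun t : 𝓞 F => e t) hw
      simp only [map_mul, map_natCast, map_sub, map_pow] at h1
      rw [← hy] at h1
      linear_combination h1
    have hpfix : τ (p : PadicAlgCl p) = p := map_natCast τ p
    have hτy : τ y = y + D y := by rw [hD, add_sub_cancel]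
    have hDy : D y = ((y + D y) ^ q - y ^ q) - (p : PadicAlgCl p) * D (e w) := by
      have h2 : D y = D (y ^ q) - D ((p : PadicAlgCl p) * e w) := by
        conv_lhs => rw [hyq]
        rw [map_sub]
      calc D y = D (y ^ q) - D ((p : PadicAlgCl p) * e w) := h2
        _ = ((τ y) ^ q - y ^ q) - (p : PadicAlgCl p) * D (e w) := by
          rw [hDmul _ _ hpfix, hD (y ^ q), map_pow]
        _ = ((y + D y) ^ q - y ^ q) - (p : PadicAlgCl p) * D (e w) := by rw [hτy]
    have hsub : ∀ a c : PadicAlgCl p, ‖a - c‖ ≤ max ‖a‖ ‖c‖ := fun a c => by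
      rw [sub_eq_add_neg, ← norm_neg c]
      exact IsUltrametricDist.norm_add_le_max a (-c)
    rw [hDy]
    refine (hsub _ _).trans (max_le ?_ ?_)
    · refine (norm_add_pow_sub_pow_le p f (hnorm (B i)) ((hlt (B i)).le)).trans ?_
      refine max_le_max ?_ ?_
      · exact mul_le_mul_of_nonneg_left (hMi i) (norm_nonneg _)
      · exact pow_le_pow_left₀ (norm_nonneg _) (hMi i) _
    · refine le_max_of_le_left ?_
      rw [norm_mul]
      exact mul_le_mul_of_nonneg_left (hDb w) (norm_nonneg _)
  -- hence `M = 0`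
  have hMle : M ≤ max (‖(p : PadicAlgCl p)‖ * M) (M ^ q) := by
    rw [hM, Finset.sup'_le_iff]
    exact fun i _ => hkey i
  have hMz : M = 0 := by
    by_contra hne0
    have hMpos : 0 < M := lt_of_le_of_ne hM0 (Ne.symm hne0)
    have h1 : ‖(p : PadicAlgCl p)‖ * M < M :=
      mul_lt_of_lt_one_left hMpos hnormp
    have h2 : M ^ q < M := by
      calc M ^ q ≤ M ^ 2 := pow_le_pow_of_le_one hM0 hM1.le hq2
        _ = M * M := sq M
        _ < M * 1 := mul_lt_mul_of_pos_left hM1 hMpos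
        _ = M := mul_one M
    exact absurd hMle (not_le.mpr (max_lt h1 h2))
  -- so `τ` fixes `e (𝓞 F)` …
  have hfix : ∀ b : 𝓞 F, τ (e b) = e b := by
    intro b
    have h := hDb b
    rw [hMz] at h
    have h0 : D (e b) = 0 := norm_le_zero_iff.mp h
    rwa [hD, sub_eq_zero] at h0
  -- … and `e F` (fractions)
  obtain ⟨a, b, hb, hab⟩ := IsFractionRing.div_surjective (A := 𝓞 F) (⟨x, hx⟩ : F)
  have hxe : ι.symm x = e a / e b := by
    rw [← map_div₀ e, hab]; rfl
  rw [hxe, map_div₀, hfix a, hfix b]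

/-- **T6 (= G3) OF RECORD — x11b3-p7's text VERBATIM (INBOX l.5038, `K4-INTERFACES.md` v4 §T6),
binder-free** (the tree's local-field structure on `ℚ_[p]` is supplied inside the proof by
`Padic.isNonarchimedeanLocalField_holds p`): for every `ι : PadicAlgCl p ≃+* ℂ`, every
`F : IntermediateField ℚ ℂ` finite over `ℚ` with `P.ramificationIdx (𝓞 ℚ) = 1` at every prime
`P ∋ p`, and every `τ : PadicAlgCl p ≃ₐ[ℚ_[p]] PadicAlgCl p` fixing the roots of unity of order prime
to `p`, `τ (ι.symm x) = ι.symm x` for all `x ∈ F` (`apply_symm_eq_of_mem`).  K4-C's labelled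
hypothesis `hUnr` is discharged by `exact` with this theorem at `p := 3`.
[cite: SerreLocalFields1979, Ch. IV §4 Cor. 2 to Prop. 16]
[cite: NeukirchANT1999, Ch. II §7 (7.12)] -/
theorem apply_symm_eq_of_forall_rootsOfUnity_of_ramificationIdx_eq_one :
    ∀ (ι : PadicAlgCl p ≃+* ℂ) (F : IntermediateField ℚ ℂ), FiniteDimensional ℚ F →
      (∀ P : Ideal (𝓞 F), P.IsPrime → ((p : ℕ) : 𝓞 F) ∈ P → P.ramificationIdx (𝓞 ℚ) = 1) →
      ∀ τ : PadicAlgCl p ≃ₐ[ℚ_[p]] PadicAlgCl p,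
        (∀ ζ : PadicAlgCl p, (∃ m : ℕ, 0 < m ∧ ¬ p ∣ m ∧ ζ ^ m = 1) → τ ζ = ζ) →
        ∀ x : ℂ, x ∈ F → τ (ι.symm x) = ι.symm x := by
  haveI := Padic.isNonarchimedeanLocalField_holds p
  intro ι F hF hunr τ hτ x hx
  exact apply_symm_eq_of_mem p ι F hF hunr τ hτ x hx

end Summit.BirchSwinnertonDyer.Rank1Residual.X11b.UnramifiedInertia
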